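import Summits.CriticalPhenomena.CardyFormulaZ2.Theorems.CardyFlipRussoVoronoiHubFromSmirnovDefs
import Literature.Probability.Percolation.VoronoiCrossing
import HarnessLib

/-!
# Hitting events of the Poisson–Voronoi black region are measurable (stub `stub_measurableCrossEvent`, part 1)

Helper file `--supports stmt-CriticalPhenomena-6433` (line `moebius-exact-delaunay-dilation-ward`,
stub S0 `stub_measurableCrossEvent` of the crux `VoronoiHubFromSmirnov`).  In the σ-algebra on
`PointConfig ℂ` generated by the counting maps (`PointConfig.instMeasurableSpace`):

* `measurable_infDist_coe` — for every `z`, the distance `c ↦ infDist z c` to the configuration is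
  measurable (`{infDist z c < r} = {N(univ) = 0} ∪ {N(ball z r) ≠ 0}` for `r > 0`);
* `measurableSet_blackRegion_inter_nonempty` — for every COMPACT `F ⊆ ℂ` and every mesh `δ`, the
  hitting event `{c | F ∩ B_δ(c) ≠ ∅}` of the closed black region
  `B_δ(c) = {z | infDist (z/δ) c.1 ≤ infDist (z/δ) c.2}` (`Literature.Probability.Percolation.blackRegion`
  read at scale `δ`) is measurable in the product σ-algebra: `g_c(z) = infDist (z/δ) c.1 - infDist (z/δ) c.2`
  is measurable in `c` and continuous in `z`, so `F ∩ B_δ(c) ≠ ∅ ⟺ min_F g_c ≤ 0 ⟺ ∀ n, ∃ d ∈ D,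
  g_c(d) < 1/(n+1)` for a countable dense `D ⊆ F`.

These are the "Effros measurability" inputs of S0; the topological reduction of the crossing event to
hitting events is in the companion file `…StubMeasurableCrossEventContinuum.lean`.
-/

noncomputable section

namespace Summit.CriticalPhenomena.CardyFormulaZ2.Cruxes.VoronoiHubFromSmirnov.MoebiusExactDelaunayDilationWard

open scoped Topology
open Set MeasureTheory Metric Filter
open Literature.Analysis.FunctionSpaces
open Literature.Probability.RandomPlanarGeometry

/-- **The distance to a configuration is measurable.** For every point `z`, the map
`c ↦ infDist z c` on locally finite configurations is measurable for the count σ-algebra: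
for `r > 0`, `infDist z c < r` iff `c = ∅` (junk value `infDist z ∅ = 0`) or `c` has a point in the
open ball `ball z r`, i.e. iff `N(univ) = 0` or `N(ball z r) ≠ 0`. -/
theorem measurable_infDist_coe : ∀ (z : ℂ), Measurable fun c : PointConfig ℂ => Metric.infDist z (c : Set ℂ) := by
  intro z
  refine measurable_of_Iio fun r => ?_
  rcases le_or_gt r 0 with hr | hr
  · have h : (fun c : PointConfig ℂ => infDist z (c : Set ℂ)) ⁻¹' Iio r = ∅ := by
      ext c
      simp only [mem_preimage, mem_Iio, mem_empty_iff_false, iff_false, not_lt]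
      exact hr.trans infDist_nonneg
    rw [h]
    exact MeasurableSet.empty
  · have h : (fun c : PointConfig ℂ => infDist z (c : Set ℂ)) ⁻¹' Iio r =
        (fun c : PointConfig ℂ => c.count univ) ⁻¹' {0} ∪
          (fun c : PointConfig ℂ => c.count (ball z r)) ⁻¹' {0}ᶜ := by
      ext c
      simp only [mem_preimage, mem_Iio, mem_union, mem_singleton_iff, mem_compl_iff,
        PointConfig.count, inter_univ, Set.encard_eq_zero, PointConfig.coe_eq_carrier]
      rcases c.carrier.eq_empty_or_nonempty with hc | hc
      · simp only [hc, infDist_empty, hr, empty_inter, true_or]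
      · rw [infDist_lt_iff hc]
        constructor
        · rintro ⟨y, hy, hyd⟩
          exact Or.inr fun h => (eq_empty_iff_forall_notMem.1 h) y ⟨hy, mem_ball'.2 hyd⟩
        · rintro (h | h)
          · exact absurd h hc.ne_empty
          · obtain ⟨y, hy, hyd⟩ := nonempty_iff_ne_empty.2 h
            exact ⟨y, hy, mem_ball'.1 hyd⟩
    rw [h]
    exact ((PointConfig.measurable_count MeasurableSet.univ) (measurableSet_singleton 0)).union
      ((PointConfig.measurable_count measurableSet_ball) (measurableSet_singleton 0).compl)

/-- The signed distance comparison `g_c(z) = infDist (z/δ) c.1 - infDist (z/δ) c.2` is measurable in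
the pair of configurations `c`, for every fixed point `z`. -/
theorem measurable_infDist_div_sub (δ : ℝ) (z : ℂ) :
    Measurable fun c : PointConfig ℂ × PointConfig ℂ =>
      infDist (z / (δ : ℂ)) (c.1 : Set ℂ) - infDist (z / (δ : ℂ)) (c.2 : Set ℂ) :=
  ((measurable_infDist_coe _).comp measurable_fst).sub ((measurable_infDist_coe _).comp measurable_snd)

/-- The signed distance comparison `g_c(z) = infDist (z/δ) c.1 - infDist (z/δ) c.2` is continuous in
`z`, for every fixed pair of configurations `c` (each `infDist` is `1`-Lipschitz). -/
theorem continuous_infDist_div_sub (δ : ℝ) (c : PointConfig ℂ × PointConfig ℂ) :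
    Continuous fun z : ℂ => infDist (z / (δ : ℂ)) (c.1 : Set ℂ) - infDist (z / (δ : ℂ)) (c.2 : Set ℂ) :=
  ((continuous_infDist_pt _).comp (continuous_id.div_const _)).sub
    ((continuous_infDist_pt _).comp (continuous_id.div_const _))

/-- The black region at mesh `δ` (ties black), `{z | infDist (z/δ) c.1 ≤ infDist (z/δ) c.2}`, is closed. -/
theorem isClosed_setOf_infDist_div_le (δ : ℝ) (c : PointConfig ℂ × PointConfig ℂ) :
    IsClosed {z : ℂ | infDist (z / (δ : ℂ)) (c.1 : Set ℂ) ≤ infDist (z / (δ : ℂ)) (c.2 : Set ℂ)} :=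
  isClosed_le ((continuous_infDist_pt _).comp (continuous_id.div_const _))
    ((continuous_infDist_pt _).comp (continuous_id.div_const _))

/-- **Hitting events of the black region are measurable.** For every compact `F ⊆ ℂ` and every mesh
`δ`, the set of pairs of configurations `c = (black nuclei, white nuclei)` whose closed black region
`{z | infDist (z/δ) c.1 ≤ infDist (z/δ) c.2}` meets `F` is measurable in the product of the count
σ-algebras.  Proof: with `g_c(z) = infDist (z/δ) c.1 - infDist (z/δ) c.2` (measurable in `c`,
continuous in `z`) and a countable dense `D ⊆ F`, the event is `⋂ₙ ⋃_{d ∈ D} {c | g_c(d) < 1/(n+1)}`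
(a minimiser of `g_c` on the compact `F` is approximated from `D`). -/
theorem measurableSet_blackRegion_inter_nonempty : ∀ (F : Set ℂ), IsCompact F → ∀ (δ : ℝ), MeasurableSet {c : PointConfig ℂ × PointConfig ℂ | (F ∩ {z | Metric.infDist (z / (δ : ℂ)) (c.1 : Set ℂ) ≤ Metric.infDist (z / (δ : ℂ)) (c.2 : Set ℂ)}).Nonempty} := by
  intro F hF δ
  rcases F.eq_empty_or_nonempty with rfl | hFne
  · simp only [empty_inter, Set.not_nonempty_empty, setOf_false, MeasurableSet.empty]
  obtain ⟨D, hDF, hDc, hFD⟩ :=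
    (TopologicalSpace.IsSeparable.of_separableSpace F).exists_countable_dense_subset
  have key : {c : PointConfig ℂ × PointConfig ℂ | (F ∩ {z | infDist (z / (δ : ℂ)) (c.1 : Set ℂ) ≤
        infDist (z / (δ : ℂ)) (c.2 : Set ℂ)}).Nonempty} =
      ⋂ n : ℕ, ⋃ d ∈ D, {c : PointConfig ℂ × PointConfig ℂ |
        infDist (d / (δ : ℂ)) (c.1 : Set ℂ) - infDist (d / (δ : ℂ)) (c.2 : Set ℂ) < 1 / ((n : ℝ) + 1)} := by
    ext c
    simp only [mem_setOf_eq, mem_iInter, mem_iUnion, exists_prop]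
    obtain ⟨z₀, hz₀F, hz₀⟩ := hF.exists_isMinOn hFne (continuous_infDist_div_sub δ c).continuousOn
    constructor
    · rintro ⟨z, hzF, hz⟩ n
      have hpos : (0 : ℝ) < 1 / ((n : ℝ) + 1) := Nat.one_div_pos_of_nat
      obtain ⟨η, hη, hηg⟩ :=
        Metric.continuousAt_iff.1 (continuous_infDist_div_sub δ c).continuousAt _ hpos
      obtain ⟨d, hdD, hzd⟩ := Metric.mem_closure_iff.1 (hFD hzF) η hη
      refine ⟨d, hdD, ?_⟩
      have h1 := hηg (show dist d z < η by rwa [dist_comm])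
      rw [Real.dist_eq] at h1
      have h2 : infDist (z / (δ : ℂ)) (c.1 : Set ℂ) - infDist (z / (δ : ℂ)) (c.2 : Set ℂ) ≤ 0 :=
        sub_nonpos.2 hz
      linarith [(abs_lt.1 h1).2]
    · intro h
      refine ⟨z₀, hz₀F, ?_⟩
      rw [mem_setOf_eq, ← sub_nonpos]
      by_contra hlt
      push Not at hlt
      obtain ⟨n, hn⟩ := exists_nat_one_div_lt hlt
      obtain ⟨d, hdD, hd⟩ := h n
      have hmin := hz₀ (hDF hdD)
      rw [mem_setOf_eq] at hmin
      linarith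
  rw [key]
  exact MeasurableSet.iInter fun n => MeasurableSet.biUnion hDc fun d _ =>
    measurableSet_lt (measurable_infDist_div_sub δ d) measurable_const

end Summit.CriticalPhenomena.CardyFormulaZ2.Cruxes.VoronoiHubFromSmirnov.MoebiusExactDelaunayDilationWard

end
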